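import Summits.BirchSwinnertonDyer.BirchSwinnertonDyer.Theorems.ResidualThetaTransportAtTwoSignedMuVanishingAtTwoPlusCuspSpanFourPowWords
import HarnessLib

/-!
# Route `ResidualThetaTransportAtTwo`, crux Kμ⁺ `SignedMuVanishingAtTwoPlus` (stmt-BirchSwinnertonDyer-20689),
# line `birth`, stub `stub_flatMuZeroAtTwo`: **the `4^k`-elements generate `Γ₀(p)` when `⟨−1, 4⟩ = (ℤ/p)ˣ`**
# (Reidemeister–Schreier walk with Rademacher's transversal; sequel of `…CuspSpanFourPowWords`)

Cell `bsd-wall`, lead `bsd-wall-rtt-p4` (g6). THEOREMS ONLY (no `def`, no named fact, no `sorry`); helper `--supports`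
the crux; BSD is not proved by this.

* `isUnit_four_of_units_eq`, `exists_lift_of_units_eq`, `lift_eq_zero_of_cast_eq_zero` — under the hypothesis
  «every non-zero residue mod `p` is `±4^k`, `k ≥ 1`» every residue has an integer lift in `{0} ∪ {±4^k : k ≥ 1}`.
* `step_T_zpow_of_ne_zero`, `step_S_of_ne_zero_of_ne_zero` — the Schreier generators at a coset `Γ₀(p) S T^ℓ`:
  `S T^ℓ T^e (S T^{ℓ'})⁻¹ = S T^{ℓ+e−ℓ'} S⁻¹` (a lower unipotent `≡ 1 mod p`) and `S T^ℓ S (S T^{ℓ'})⁻¹ =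
  S T^ℓ S T^{−ℓ'} S⁻¹` (a Rademacher word, itself a `4^k`-element).
* `exists_rep_mul_inv_mem` — **the walk**: for every `g ∈ SL(2, ℤ) = ⟨S, T⟩` (`SpecialLinearGroup.SL2Z_generators`,
  `Subgroup.closure_induction_right`) there is a Rademacher representative `r` of `Γ₀(p) g` (`r = 1` if `p ∣ c(g)`,
  else `r = S T^ℓ`, `ℓ c ≡ d`, `ℓ ∈ {0} ∪ ±4^ℕ⁺`) with `g r⁻¹ ∈ K`, for any `K ≤ SL(2, ℤ)` containing the `4^k`-elements
  of `Γ₀(p)`; `mem_of_fourPow_mem_of_mem_gamma0` — so `Γ₀(p) ≤ K`;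
  `closure_fourPow_eq_top_of_units_eq` — **inside `Γ₀(p)`, the `4^k`-elements generate everything.**

For such `p` this is far more than (G′)_p (which only needs `Γ₁'(p) ≤ M_p`); the consequences for the named
predicate `CuspSpanEvenAtTwo p` and for FLAT are drawn in `…CuspSpanPrimeLevel`. Nothing is claimed at other levels.

References: H. Rademacher, Abh. Math. Sem. Hamburg 7 (1929) 134–148 [Rademacher1929]; A. W. Knapp, *Elliptic
curves* (1992) Prop. 11.22 [Knapp1993]; R. Pollack, Duke Math. J. 118 (2003) Conj. 6.3 [Pollack2003].
-/

set_option autoImplicit false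
set_option linter.dupNamespace false

noncomputable section

open scoped Classical MatrixGroups

open CongruenceSubgroup Matrix.SpecialLinearGroup ModularGroup Literature.NumberTheory.Automorphic
  Summit.BirchSwinnertonDyer.Rank2.LevelFifteen

namespace Summit.BirchSwinnertonDyer.BirchSwinnertonDyer.Theorems.SignedMuAtTwo

/-! ## §3. Reidemeister–Schreier walk: with Rademacher's transversal `{1} ∪ {S T^ℓ}` (lifts `ℓ ∈ {0} ∪ ±4^ℕ⁺`) every
Schreier generator is a quotient of `4^k`-elements, so `Γ₀(p)` lies in the subgroup they generate -/

section Walk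

variable {p : ℕ} [Fact p.Prime] {K : Subgroup SL(2, ℤ)}

/-- `4` is a unit mod `p` as soon as some non-zero residue is `±4^k` with `k ≥ 1` (so `p ≠ 2`). [folklore] -/
theorem isUnit_four_of_units_eq
    (hH : ∀ j : ZMod p, j ≠ 0 → ∃ k : ℕ, 1 ≤ k ∧ (j = 4 ^ k ∨ j = -(4 ^ k))) : IsUnit (4 : ZMod p) := by
  obtain ⟨k, hk, h | h⟩ := hH 1 one_ne_zero
  · exact (isUnit_pow_iff (by omega)).mp (h ▸ isUnit_one)
  · have : IsUnit ((4 : ZMod p) ^ k) := by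
      have h' : (4 : ZMod p) ^ k = -1 := by linear_combination h
      rw [h']; exact isUnit_one.neg
    exact (isUnit_pow_iff (by omega)).mp this

/-- **Lifts.** Under `⟨−1, 4⟩ = (ℤ/p)ˣ` every residue mod `p` has an integer lift in `{0} ∪ {±4^k : k ≥ 1}`. [folklore] -/
theorem exists_lift_of_units_eq
    (hH : ∀ j : ZMod p, j ≠ 0 → ∃ k : ℕ, 1 ≤ k ∧ (j = 4 ^ k ∨ j = -(4 ^ k))) (j : ZMod p) :
    ∃ ℓ : ℤ, (ℓ : ZMod p) = j ∧ (ℓ = 0 ∨ ∃ k : ℕ, 1 ≤ k ∧ ℓ.natAbs = 4 ^ k) := by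
  by_cases hj : j = 0
  · exact ⟨0, by rw [hj, Int.cast_zero], Or.inl rfl⟩
  · obtain ⟨k, hk, h | h⟩ := hH j hj
    · refine ⟨(4 : ℤ) ^ k, by rw [h]; push_cast; rfl, Or.inr ⟨k, hk, ?_⟩⟩
      rw [Int.natAbs_pow]; rfl
    · refine ⟨-(4 : ℤ) ^ k, by rw [h]; push_cast; rfl, Or.inr ⟨k, hk, ?_⟩⟩
      rw [Int.natAbs_neg, Int.natAbs_pow]; rfl

/-- A lift `ℓ ∈ {0} ∪ ±4^ℕ⁺` reduces to `0` mod `p` only if `ℓ = 0` (`4` being a unit mod `p`). [folklore] -/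
theorem lift_eq_zero_of_cast_eq_zero (h4 : IsUnit (4 : ZMod p)) {ℓ : ℤ}
    (hℓ : ℓ = 0 ∨ ∃ k : ℕ, 1 ≤ k ∧ ℓ.natAbs = 4 ^ k) (h0 : (ℓ : ZMod p) = 0) : ℓ = 0 := by
  rcases hℓ with rfl | ⟨k, -, hk⟩
  · rfl
  · exfalso
    have hu : IsUnit ((ℓ : ℤ) : ZMod p) := by
      rcases Int.natAbs_eq ℓ with h | h <;> rw [h, hk] <;> push_cast
      · exact h4.pow k
      · exact (h4.pow k).neg
    rw [h0] at hu
    exact not_isUnit_zero hu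

/-- **Step `T^{e}` from a coset with `c ≢ 0`**: the Schreier generator `S T^ℓ T^{e} (S T^{ℓ'})⁻¹ = S T^{ℓ+e−ℓ'} S⁻¹`
(`ℓ' ≡ ℓ + e`) is a lower unipotent `≡ 1 (mod p)`. [folklore] -/
theorem step_T_zpow_of_ne_zero (h4 : IsUnit (4 : ZMod p))
    (hH : ∀ j : ZMod p, j ≠ 0 → ∃ k : ℕ, 1 ≤ k ∧ (j = 4 ^ k ∨ j = -(4 ^ k)))
    (hK : ∀ γ : SL(2, ℤ), γ ∈ Gamma0 p → (∃ k : ℕ, 1 ≤ k ∧ (γ 1 1).natAbs = 4 ^ k) → γ ∈ K)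
    {g : SL(2, ℤ)} {ℓ : ℤ} (e : ℤ)
    (hℓc : (ℓ : ZMod p) * ((g 1 0 : ℤ) : ZMod p) = ((g 1 1 : ℤ) : ZMod p))
    (hgr : g * (S * T ^ ℓ)⁻¹ ∈ K) :
    ∃ ℓ' : ℤ, (ℓ' : ZMod p) * (((g * T ^ e) 1 0 : ℤ) : ZMod p) = (((g * T ^ e) 1 1 : ℤ) : ZMod p) ∧
      (ℓ' = 0 ∨ ∃ k : ℕ, 1 ≤ k ∧ ℓ'.natAbs = 4 ^ k) ∧ g * T ^ e * (S * T ^ ℓ')⁻¹ ∈ K := by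
  obtain ⟨ℓ', hℓ', hℓ'4⟩ := exists_lift_of_units_eq hH ((ℓ : ZMod p) + e)
  refine ⟨ℓ', ?_, hℓ'4, ?_⟩
  · rw [mul_T_zpow_apply_one_zero, mul_T_zpow_apply_one_one, hℓ', Int.cast_add, Int.cast_mul, ← hℓc]
    ring
  · have hfac : g * T ^ e * (S * T ^ ℓ')⁻¹ = (g * (S * T ^ ℓ)⁻¹) * (S * T ^ (ℓ + e - ℓ') * S⁻¹) := by group
    rw [hfac]
    refine K.mul_mem hgr (S_mul_T_zpow_mul_S_inv_mem_of_fourPow_mem h4 hK ?_)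
    rw [Int.cast_sub, Int.cast_add, hℓ']
    ring

/-- **Step `S` from a coset with `c ≢ 0`, `d ≢ 0`**: the Schreier generator is the Rademacher word
`S T^ℓ S T^{−ℓ'} S⁻¹` with `|ℓ| = 4^k` and `ℓ ℓ' ≡ −1`, a `4^k`-element of `Γ₀(p)`. [folklore] -/
theorem step_S_of_ne_zero_of_ne_zero
    (hH : ∀ j : ZMod p, j ≠ 0 → ∃ k : ℕ, 1 ≤ k ∧ (j = 4 ^ k ∨ j = -(4 ^ k)))
    (hK : ∀ γ : SL(2, ℤ), γ ∈ Gamma0 p → (∃ k : ℕ, 1 ≤ k ∧ (γ 1 1).natAbs = 4 ^ k) → γ ∈ K)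
    {g : SL(2, ℤ)} {ℓ : ℤ} (hd : ((g 1 1 : ℤ) : ZMod p) ≠ 0)
    (hℓc : (ℓ : ZMod p) * ((g 1 0 : ℤ) : ZMod p) = ((g 1 1 : ℤ) : ZMod p))
    (hℓ4 : ∃ k : ℕ, 1 ≤ k ∧ ℓ.natAbs = 4 ^ k)
    (hgr : g * (S * T ^ ℓ)⁻¹ ∈ K) :
    ∃ ℓ' : ℤ, (ℓ' : ZMod p) * (((g * S) 1 0 : ℤ) : ZMod p) = (((g * S) 1 1 : ℤ) : ZMod p) ∧
      (ℓ' = 0 ∨ ∃ k : ℕ, 1 ≤ k ∧ ℓ'.natAbs = 4 ^ k) ∧ g * S * (S * T ^ ℓ')⁻¹ ∈ K := by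
  obtain ⟨ℓ', hℓ', hℓ'4⟩ := exists_lift_of_units_eq hH (-((g 1 0 : ℤ) : ZMod p) * (((g 1 1 : ℤ) : ZMod p))⁻¹)
  refine ⟨ℓ', ?_, hℓ'4, ?_⟩
  · rw [mul_S_apply_10, mul_S_apply_11, hℓ', Int.cast_neg, mul_assoc, inv_mul_cancel₀ hd, mul_one]
  · have hfac : g * S * (S * T ^ ℓ')⁻¹ = (g * (S * T ^ ℓ)⁻¹) * (S * T ^ ℓ * S * T ^ (-ℓ') * S⁻¹) := by group
    rw [hfac]
    refine K.mul_mem hgr (rademacherWord_mem_of_fourPow_mem hK hℓ4 ?_)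
    rw [Int.cast_add, Int.cast_mul, Int.cast_one, hℓ',
      show (ℓ : ZMod p) * (-((g 1 0 : ℤ) : ZMod p) * (((g 1 1 : ℤ) : ZMod p))⁻¹) + 1 =
        -((ℓ : ZMod p) * ((g 1 0 : ℤ) : ZMod p)) * (((g 1 1 : ℤ) : ZMod p))⁻¹ + 1 by ring,
      hℓc, neg_mul, mul_inv_cancel₀ hd, neg_add_cancel]

/-- **The Reidemeister–Schreier walk.** Assume `⟨−1, 4⟩ = (ℤ/p)ˣ` and let `K ≤ SL(2, ℤ)` contain every element of
`Γ₀(p)` with lower-right entry `±4^k`, `k ≥ 1`. Then every `g ∈ SL(2, ℤ)` has a coset representative `r` for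
`Γ₀(p) g` of Rademacher's shape — `r = 1` if `p ∣ c(g)`, else `r = S T^ℓ` with `ℓ c ≡ d (mod p)` and
`ℓ ∈ {0} ∪ {±4^k : k ≥ 1}` — such that `g r⁻¹ ∈ K`. Proof: induction over `SL(2, ℤ) = ⟨S, T⟩`
(`SpecialLinearGroup.SL2Z_generators`); each Schreier generator `r s r'⁻¹` (`s ∈ {S^{±1}, T^{±1}}`) is `T^{±1}`,
`−1`, a lower unipotent `≡ 1 (mod p)` or a Rademacher word `S T^{±4^k} S T^{−ℓ'} S⁻¹`, all in `K` by §2.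
[cite: Knapp1993, Prop. 11.22] -/
theorem exists_rep_mul_inv_mem
    (hH : ∀ j : ZMod p, j ≠ 0 → ∃ k : ℕ, 1 ≤ k ∧ (j = 4 ^ k ∨ j = -(4 ^ k)))
    (hK : ∀ γ : SL(2, ℤ), γ ∈ Gamma0 p → (∃ k : ℕ, 1 ≤ k ∧ (γ 1 1).natAbs = 4 ^ k) → γ ∈ K)
    (g : SL(2, ℤ)) :
    ∃ r : SL(2, ℤ),
      ((((g 1 0 : ℤ) : ZMod p) = 0 → r = 1) ∧
        (((g 1 0 : ℤ) : ZMod p) ≠ 0 → ∃ ℓ : ℤ, r = S * T ^ ℓ ∧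
          (ℓ : ZMod p) * ((g 1 0 : ℤ) : ZMod p) = ((g 1 1 : ℤ) : ZMod p) ∧
          (ℓ = 0 ∨ ∃ k : ℕ, 1 ≤ k ∧ ℓ.natAbs = 4 ^ k))) ∧
      g * r⁻¹ ∈ K := by
  have h4 : IsUnit (4 : ZMod p) := isUnit_four_of_units_eq hH
  have hT : (T : SL(2, ℤ)) ∈ K := T_mem_of_fourPow_mem h4 hK
  have hneg : (-1 : SL(2, ℤ)) ∈ K := neg_one_mem_of_fourPow_mem h4 hK
  -- the `T^{±1}`-step
  have stepT : ∀ (e : ℤ), (e = 1 ∨ e = -1) → ∀ x : SL(2, ℤ),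
      (∃ r : SL(2, ℤ),
        ((((x 1 0 : ℤ) : ZMod p) = 0 → r = 1) ∧
          (((x 1 0 : ℤ) : ZMod p) ≠ 0 → ∃ ℓ : ℤ, r = S * T ^ ℓ ∧
            (ℓ : ZMod p) * ((x 1 0 : ℤ) : ZMod p) = ((x 1 1 : ℤ) : ZMod p) ∧
            (ℓ = 0 ∨ ∃ k : ℕ, 1 ≤ k ∧ ℓ.natAbs = 4 ^ k))) ∧ x * r⁻¹ ∈ K) →
      (∃ r : SL(2, ℤ),
        (((((x * T ^ e) 1 0 : ℤ) : ZMod p) = 0 → r = 1) ∧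
          ((((x * T ^ e) 1 0 : ℤ) : ZMod p) ≠ 0 → ∃ ℓ : ℤ, r = S * T ^ ℓ ∧
            (ℓ : ZMod p) * (((x * T ^ e) 1 0 : ℤ) : ZMod p) = (((x * T ^ e) 1 1 : ℤ) : ZMod p) ∧
            (ℓ = 0 ∨ ∃ k : ℕ, 1 ≤ k ∧ ℓ.natAbs = 4 ^ k))) ∧ x * T ^ e * r⁻¹ ∈ K) := by
    intro e he x ⟨r, ⟨h0, h1⟩, hxr⟩
    by_cases hc : ((x 1 0 : ℤ) : ZMod p) = 0
    · -- `c ≡ 0`: representative `1` before and after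
      have hr : r = 1 := h0 hc
      subst hr
      refine ⟨1, ⟨fun _ ↦ rfl, fun h ↦ absurd (by rwa [mul_T_zpow_apply_one_zero]) h⟩, ?_⟩
      rw [inv_one, mul_one] at hxr ⊢
      rcases he with rfl | rfl
      · rw [zpow_one]; exact K.mul_mem hxr hT
      · rw [zpow_neg, zpow_one]; exact K.mul_mem hxr (K.inv_mem hT)
    · obtain ⟨ℓ, rfl, hℓc, hℓ4⟩ := h1 hc
      obtain ⟨ℓ', hℓ'c, hℓ'4, hmem⟩ := step_T_zpow_of_ne_zero h4 hH hK e hℓc hxr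
      refine ⟨S * T ^ ℓ', ⟨fun h ↦ absurd (by rwa [mul_T_zpow_apply_one_zero] at h) hc, fun _ ↦ ⟨ℓ', rfl, hℓ'c, hℓ'4⟩⟩,
        hmem⟩
  -- the `S`-step
  have stepS : ∀ x : SL(2, ℤ),
      (∃ r : SL(2, ℤ),
        ((((x 1 0 : ℤ) : ZMod p) = 0 → r = 1) ∧
          (((x 1 0 : ℤ) : ZMod p) ≠ 0 → ∃ ℓ : ℤ, r = S * T ^ ℓ ∧
            (ℓ : ZMod p) * ((x 1 0 : ℤ) : ZMod p) = ((x 1 1 : ℤ) : ZMod p) ∧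
            (ℓ = 0 ∨ ∃ k : ℕ, 1 ≤ k ∧ ℓ.natAbs = 4 ^ k))) ∧ x * r⁻¹ ∈ K) →
      (∃ r : SL(2, ℤ),
        (((((x * S) 1 0 : ℤ) : ZMod p) = 0 → r = 1) ∧
          ((((x * S) 1 0 : ℤ) : ZMod p) ≠ 0 → ∃ ℓ : ℤ, r = S * T ^ ℓ ∧
            (ℓ : ZMod p) * (((x * S) 1 0 : ℤ) : ZMod p) = (((x * S) 1 1 : ℤ) : ZMod p) ∧
            (ℓ = 0 ∨ ∃ k : ℕ, 1 ≤ k ∧ ℓ.natAbs = 4 ^ k))) ∧ x * S * r⁻¹ ∈ K) := by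
    intro x ⟨r, ⟨h0, h1⟩, hxr⟩
    have hcd := not_cast_apply_one_zero_eq_zero_and (p := p) x
    by_cases hc : ((x 1 0 : ℤ) : ZMod p) = 0
    · -- `c ≡ 0`, so `d ≢ 0`: new representative `S T⁰ = S`, Schreier generator `1`
      have hr : r = 1 := h0 hc
      subst hr
      have hd : ((x 1 1 : ℤ) : ZMod p) ≠ 0 := fun h ↦ hcd ⟨hc, h⟩
      refine ⟨S * T ^ (0 : ℤ), ⟨fun h ↦ absurd (by rwa [mul_S_apply_10] at h) hd, fun _ ↦ ⟨0, rfl, ?_, Or.inl rfl⟩⟩, ?_⟩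
      · rw [mul_S_apply_11, Int.cast_neg, hc, neg_zero, Int.cast_zero, zero_mul]
      · rw [inv_one, mul_one] at hxr
        simpa using hxr
    · obtain ⟨ℓ, rfl, hℓc, hℓ4⟩ := h1 hc
      by_cases hd : ((x 1 1 : ℤ) : ZMod p) = 0
      · -- `c ≢ 0`, `d ≡ 0`: `ℓ = 0`, new representative `1`, Schreier generator `S S = −1`
        have hℓ0 : ℓ = 0 := by
          refine lift_eq_zero_of_cast_eq_zero h4 hℓ4 ?_
          have hu : IsUnit ((x 1 0 : ℤ) : ZMod p) := (Ne.isUnit hc)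
          have := hℓc
          rw [hd] at this
          exact (hu.mul_left_eq_zero).mp this
        subst hℓ0
        refine ⟨1, ⟨fun _ ↦ rfl, fun h ↦ absurd (by rwa [mul_S_apply_10]) h⟩, ?_⟩
        have hfac : x * S * (1 : SL(2, ℤ))⁻¹ = (x * (S * T ^ (0 : ℤ))⁻¹) * (S * S) := by group
        have hSS : (S * S : SL(2, ℤ)) = -1 :=
          eq_mul_inv_iff_mul_eq.mp (by rw [S_inv, mul_neg, neg_one_mul, neg_neg])
        rw [hfac, hSS]
        exact K.mul_mem hxr hneg
      · -- `c ≢ 0`, `d ≢ 0`: Rademacher word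
        have hℓ4' : ∃ k : ℕ, 1 ≤ k ∧ ℓ.natAbs = 4 ^ k := by
          rcases hℓ4 with rfl | h
          · exfalso; apply hd; rw [← hℓc, Int.cast_zero, zero_mul]
          · exact h
        obtain ⟨ℓ', hℓ'c, hℓ'4, hmem⟩ := step_S_of_ne_zero_of_ne_zero hH hK hd hℓc hℓ4' hxr
        refine ⟨S * T ^ ℓ', ⟨fun h ↦ absurd (by rwa [mul_S_apply_10] at h) hd, fun _ ↦ ⟨ℓ', rfl, hℓ'c, hℓ'4⟩⟩,
          hmem⟩
  -- the `S⁻¹`-step: `x S⁻¹ = −(x S)` has the same coset data and `x S⁻¹ r⁻¹ = (x S r⁻¹)(−1)`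
  have stepSinv : ∀ x : SL(2, ℤ),
      (∃ r : SL(2, ℤ),
        ((((x 1 0 : ℤ) : ZMod p) = 0 → r = 1) ∧
          (((x 1 0 : ℤ) : ZMod p) ≠ 0 → ∃ ℓ : ℤ, r = S * T ^ ℓ ∧
            (ℓ : ZMod p) * ((x 1 0 : ℤ) : ZMod p) = ((x 1 1 : ℤ) : ZMod p) ∧
            (ℓ = 0 ∨ ∃ k : ℕ, 1 ≤ k ∧ ℓ.natAbs = 4 ^ k))) ∧ x * r⁻¹ ∈ K) →
      (∃ r : SL(2, ℤ),
        (((((x * S⁻¹) 1 0 : ℤ) : ZMod p) = 0 → r = 1) ∧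
          ((((x * S⁻¹) 1 0 : ℤ) : ZMod p) ≠ 0 → ∃ ℓ : ℤ, r = S * T ^ ℓ ∧
            (ℓ : ZMod p) * (((x * S⁻¹) 1 0 : ℤ) : ZMod p) = (((x * S⁻¹) 1 1 : ℤ) : ZMod p) ∧
            (ℓ = 0 ∨ ∃ k : ℕ, 1 ≤ k ∧ ℓ.natAbs = 4 ^ k))) ∧ x * S⁻¹ * r⁻¹ ∈ K) := by
    intro x hx
    obtain ⟨r, ⟨h0, h1⟩, hxr⟩ := stepS x hx
    have e0 : (((x * S⁻¹) 1 0 : ℤ) : ZMod p) = -((((x * S) 1 0 : ℤ) : ZMod p)) := by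
      rw [mul_S_inv_eq_neg, neg_apply, Int.cast_neg]
    have e1 : (((x * S⁻¹) 1 1 : ℤ) : ZMod p) = -((((x * S) 1 1 : ℤ) : ZMod p)) := by
      rw [mul_S_inv_eq_neg, neg_apply, Int.cast_neg]
    refine ⟨r, ⟨fun h ↦ h0 (by rwa [e0, neg_eq_zero] at h), fun h ↦ ?_⟩, ?_⟩
    · obtain ⟨ℓ, hr, hℓc, hℓ4⟩ := h1 (by rwa [e0, neg_ne_zero] at h)
      exact ⟨ℓ, hr, by rw [e0, e1, mul_neg, hℓc], hℓ4⟩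
    · have : x * S⁻¹ * r⁻¹ = x * S * r⁻¹ * (-1) := by
        rw [mul_S_inv_eq_neg, neg_mul, mul_neg_one]
      rw [this]
      exact K.mul_mem hxr hneg
  -- induction over `SL(2, ℤ) = ⟨S, T⟩`
  have hg : g ∈ Subgroup.closure ({S, T} : Set SL(2, ℤ)) := by
    rw [SpecialLinearGroup.SL2Z_generators]; exact Subgroup.mem_top g
  induction hg using Subgroup.closure_induction_right with
  | one =>
    refine ⟨1, ⟨fun _ ↦ rfl, fun h ↦ absurd ?_ h⟩, by rw [inv_one, mul_one]; exact K.one_mem⟩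
    rw [Matrix.SpecialLinearGroup.coe_one]; simp
  | mul_right x _ y hy ih =>
    rcases hy with rfl | rfl
    · exact stepS x ih
    · simpa only [zpow_one] using stepT 1 (Or.inl rfl) x ih
  | mul_inv_cancel x _ y hy ih =>
    rcases hy with rfl | rfl
    · exact stepSinv x ih
    · simpa only [zpow_neg, zpow_one] using stepT (-1) (Or.inr rfl) x ih

/-- **`Γ₀(p)` is generated by its `4^k`-elements when `⟨−1, 4⟩ = (ℤ/p)ˣ`.** For a prime `p` such that every
non-zero residue mod `p` is `±4^k` for some `k ≥ 1`, every subgroup of `SL(2, ℤ)` containing the elements of `Γ₀(p)`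
with lower-right entry `±4^k` (`k ≥ 1`) contains `Γ₀(p)`: for `γ ∈ Γ₀(p)` the Rademacher representative is `1`.
[cite: Knapp1993, Prop. 11.22] -/
theorem mem_of_fourPow_mem_of_mem_gamma0
    (hH : ∀ j : ZMod p, j ≠ 0 → ∃ k : ℕ, 1 ≤ k ∧ (j = 4 ^ k ∨ j = -(4 ^ k)))
    (hK : ∀ γ : SL(2, ℤ), γ ∈ Gamma0 p → (∃ k : ℕ, 1 ≤ k ∧ (γ 1 1).natAbs = 4 ^ k) → γ ∈ K)
    {γ : SL(2, ℤ)} (hγ : γ ∈ Gamma0 p) : γ ∈ K := by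
  obtain ⟨r, ⟨h0, -⟩, hγr⟩ := exists_rep_mul_inv_mem hH hK γ
  rw [h0 (Gamma0_mem.mp hγ), inv_one, mul_one] at hγr
  exact hγr

end Walk

end Summit.BirchSwinnertonDyer.BirchSwinnertonDyer.Theorems.SignedMuAtTwo

end
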